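import Literature.Analysis.FluidPDE.PineauVicolPressureDecayClass
import Literature.Analysis.FluidPDE.PineauVicolCylinderRegularity

/-!
# Crux `ScarRigidity` (stmt-NavierStokesRegularity-11717), line `moment-conditioned-rellich`:
# stub `stub_apexRegularity` — I: the far Newton kernel and parametric integrals at ALL orders

Helper file (`--supports stmt-NavierStokesRegularity-11717`; theorems only, no definitions, no named
facts).  The registered stub `stub_apexRegularity` asks, for a Type-I ancient mild field `V` with the apex
bound `‖V(t,x)‖ ≤ C/(‖x‖+√(−t))`, for a classical pressure `Q` with the ALL-ORDERS scale-invariant package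
`‖∇ⁿV‖ ≤ L/(‖x‖+√(−t))^{1+n}`, `‖∇ⁿQ‖ ≤ L/(‖x‖+√(−t))^{2+n}`, `‖∂ₜ∇ⁿV‖ ≤ L/(‖x‖+√(−t))^{3+n}`.  The pressure is
the Riesz pressure `Q[v] = RᵢRⱼ(vᵢvⱼ)`, realised in the tree as `pressurePotential v = −Q₁[v] − Q₂[v]`
(`PressureRepresentation.lean`: near part `Q₁[v](x) = ∫ Γ₀(z) G[v](x − z) dz` against the truncated kernel
`Γ₀ = Γ₀^{1,2} ∈ L¹`, far part `Q₂[v](x) = ∫ D²Γ∞(x − y)(v y, v y) dy` against the smooth far kernel).  The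
sibling crux `SymmetricScarExists` bounded `Q, DQ, D²Q` (`…ApexRieszPressure*.lean`); the all-orders
version needs the three elementary inputs of this file:

* `exists_hasDecay_iteratedFDeriv_newtonFar`, `exists_hasDecay_iteratedFDeriv_fderiv2_newtonFar` — **every
  derivative `DⁿΓ∞`, `n ≥ 2`, decays like `(1+|z|)⁻³`** (no homogeneity bookkeeping: for `‖z‖ ≥ 3` the germs of
  `Γ∞^{1,2}` and `Γ∞^{c,2c} = c⁻¹Γ∞^{1,2}(c⁻¹·)`, `c = ‖z‖/4`, agree, so `‖DⁿΓ∞(z)‖ ≤ (4/‖z‖)^{n+1} sup_{B̄(0,4)}‖DⁿΓ∞‖`);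
* `iteratedFDeriv_integral_smul_comp_sub_apply` — **all derivatives under the integral sign against a
  compactly supported `L¹` kernel**: `Dⁿ(∫ k(z) • g(· − z) dz)(x) m = ∫ k(z) • Dⁿg(x − z) m dz` (the tree's
  `fderiv_integral_smul_comp_sub_apply`, iterated through directional derivatives);
* `contDiff_integral_clm_apply_comp_sub_decay_of_forall`, `iteratedFDeriv_integral_clm_apply_comp_sub_decay_apply`
  — **the decay class at all orders**: for `Φ ∈ Cⁿ` with `‖DᵏΦ(z)‖ ≤ M_k/(1+|z|)³` (`k ≤ n`) and a continuous
  weight `‖L y‖ ≤ A/(1+|y|)²`, `x ↦ ∫ L(y)(Φ(x − y)) dy` is `Cⁿ` with `Dⁿ(…)(x) m = ∫ L(y)(DⁿΦ(x − y) m) dy`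
  (the tree's `hasFDerivAt_integral_clm_apply_comp_sub_decay`, iterated); consequences for the far potential
  `Q₂[v]` and the pressure potential of a field in a decay class: smooth at every order, with the formula
  `DⁿQ₂[v](x) m = ∫ DⁿΦ(x − y) m (v y, v y) dy`, `Φ = D²Γ∞` (`contDiff_farPotential_decay_all`,
  `contDiff_pressurePotential_decay_all`, `iteratedFDeriv_farPotential_apply`).

## References

* D. Gilbarg, N. S. Trudinger, *Elliptic PDE of Second Order* (2001), Lemma 4.1–4.2. [GilbargTrudinger2001]
* B. Pineau, V. Vicol, arXiv:2607.09619 (2026), Lemma 2.1, Lemma 7.1. [PineauVicol2026]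
-/

noncomputable section

open MeasureTheory Set Function Filter Topology Metric
open scoped ContDiff Laplacian

-- nested operator types (`ℝ³ →L[ℝ] ℝ³ →L[ℝ] ℝ³ →L[ℝ] ℝ`, `(X →L[ℝ] X [×n]→L[ℝ] F) →L[ℝ] X [×(n+1)]→L[ℝ] F`)
set_option maxSynthPendingDepth 4

namespace Summit.NavierStokesRegularity.NavierStokesRegularity.Theorems.RellichScarScarRigidity

open Literature.Analysis.FluidPDE
open Literature.Analysis.FluidPDE.FourierNS (HasDecay)

/-! ### All derivatives of the far Newton kernel decay like `(1+|z|)⁻³` -/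

/-- `Γ∞^{1,2}` and `Γ∞^{c,2c}` agree near every `z` with `‖z‖ > max 2 (2c)` (both are `Γ` there). [folklore] -/
theorem newtonFar_eventuallyEq_newtonFar_scale {c : ℝ} (hc : 0 < c) {z : EuclideanSpace ℝ (Fin 3)}
    (hz2 : 2 < ‖z‖) (hzc : 2 * c < ‖z‖) :
    (newtonFar (1 : ℝ) 2) =ᶠ[𝓝 z] newtonFar (c * 1) (c * 2) := by
  have hopen : IsOpen {w : EuclideanSpace ℝ (Fin 3) | max 2 (2 * c) < ‖w‖} :=
    isOpen_lt continuous_const continuous_norm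
  have hmem : z ∈ {w : EuclideanSpace ℝ (Fin 3) | max 2 (2 * c) < ‖w‖} := max_lt hz2 hzc
  filter_upwards [hopen.mem_nhds hmem] with w hw
  have hw' := max_lt_iff.1 hw
  rw [newtonFar_eq_newtonKernel zero_le_one one_lt_two hw'.1.le, mul_one,
    newtonFar_eq_newtonKernel hc.le (by linarith) (by linarith : c * 2 ≤ ‖w‖)]

/-- **Far-field decay of all derivatives of `Γ∞`**: for `‖z‖ ≥ 3`,
`‖DⁿΓ∞^{1,2}(z)‖ ≤ B_n 4^{n+1} ‖z‖^{-(n+1)}` (scaling `Γ∞^{c,2c} = c⁻¹Γ∞^{1,2}(c⁻¹·)` with `c = ‖z‖/4` and a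
bound `B_n` of `DⁿΓ∞^{1,2}` on the ball of radius `4`). [folklore] -/
theorem exists_norm_iteratedFDeriv_newtonFar_le_far (n : ℕ) :
    ∃ B : ℝ, 0 ≤ B ∧ ∀ z : EuclideanSpace ℝ (Fin 3), 3 ≤ ‖z‖ →
      ‖iteratedFDeriv ℝ n (newtonFar (1 : ℝ) 2) z‖ ≤ B * (‖z‖ ^ (n + 1))⁻¹ := by
  have hΓ : ContDiff ℝ n (newtonFar (1 : ℝ) 2) := contDiff_newtonFar one_pos one_lt_two
  have hcont : Continuous (iteratedFDeriv ℝ n (newtonFar (1 : ℝ) 2)) :=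
    hΓ.continuous_iteratedFDeriv le_rfl
  obtain ⟨B, hB⟩ := (isCompact_closedBall (0 : EuclideanSpace ℝ (Fin 3)) 4).exists_bound_of_continuousOn
    hcont.continuousOn
  have hB0 : 0 ≤ B := (norm_nonneg _).trans (hB 0 (mem_closedBall_self (by norm_num)))
  refine ⟨B * 4 ^ (n + 1), by positivity, fun z hz => ?_⟩
  have hz0 : 0 < ‖z‖ := by linarith
  set c : ℝ := ‖z‖ / 4 with hc
  have hc0 : 0 < c := by positivity
  have hgerm := newtonFar_eventuallyEq_newtonFar_scale hc0 (by linarith) (by rw [hc]; linarith)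
  have e1 : iteratedFDeriv ℝ n (newtonFar (1 : ℝ) 2) z =
      iteratedFDeriv ℝ n (newtonFar (c * 1) (c * 2)) z :=
    (hgerm.iteratedFDeriv ℝ n).eq_of_nhds
  rw [e1, newtonFar_scale' hc0]
  have h := PineauVicol2026.norm_iteratedFDeriv_unzoom_le hΓ hc0 0 z
  simp only [sub_zero] at h
  refine h.trans ?_
  have hcz : ‖c⁻¹ • z‖ = 4 := by
    rw [norm_smul, norm_inv, Real.norm_of_nonneg hc0.le, hc]
    field_simp
  have hBz : ‖iteratedFDeriv ℝ n (newtonFar 1 2) (c⁻¹ • z)‖ ≤ B :=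
    hB _ (mem_closedBall_zero_iff.2 hcz.le)
  calc c⁻¹ ^ (n + 1) * ‖iteratedFDeriv ℝ n (newtonFar 1 2) (c⁻¹ • z)‖
      ≤ c⁻¹ ^ (n + 1) * B := mul_le_mul_of_nonneg_left hBz (by positivity)
    _ = B * 4 ^ (n + 1) * (‖z‖ ^ (n + 1))⁻¹ := by
        rw [hc, inv_div, div_pow]
        field_simp

/-- **`DⁿΓ∞` decays like `(1+|z|)⁻³` for every `n ≥ 2`** (far field: `‖z‖^{-(n+1)} ≤ ‖z‖⁻³`;
near field: continuity on the ball of radius `3`). [folklore] -/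
theorem exists_hasDecay_iteratedFDeriv_newtonFar (n : ℕ) :
    ∃ M, HasDecay 3 M (iteratedFDeriv ℝ (n + 2) (newtonFar (1 : ℝ) 2)) := by
  obtain ⟨B, hB0, hB⟩ := exists_norm_iteratedFDeriv_newtonFar_le_far (n + 2)
  have hΓ : ContDiff ℝ (n + 2 : ℕ) (newtonFar (1 : ℝ) 2) := contDiff_newtonFar one_pos one_lt_two
  have hcont : Continuous (iteratedFDeriv ℝ (n + 2) (newtonFar (1 : ℝ) 2)) :=
    hΓ.continuous_iteratedFDeriv le_rfl
  obtain ⟨B', hB'⟩ := (isCompact_closedBall (0 : EuclideanSpace ℝ (Fin 3)) 3).exists_bound_of_continuousOn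
    hcont.continuousOn
  have hB'0 : 0 ≤ B' := (norm_nonneg _).trans (hB' 0 (mem_closedBall_self (by norm_num)))
  refine PineauVicol2026.hasDecay_three_of_eqOn_far hcont le_rfl (fun z _ => rfl)
    (M := max B (27 * B')) (le_max_of_le_left hB0) (m := -3) le_rfl fun z hz1 => ?_
  have hz0 : 0 < ‖z‖ := by linarith
  have hz3 : ‖z‖ ^ (-3 : ℤ) = (‖z‖ ^ 3)⁻¹ := by
    rw [show (-3 : ℤ) = -((3 : ℕ) : ℤ) by norm_num, zpow_neg, zpow_natCast]
  rw [hz3]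
  by_cases hz : 3 ≤ ‖z‖
  · calc ‖iteratedFDeriv ℝ (n + 2) (newtonFar 1 2) z‖ ≤ B * (‖z‖ ^ (n + 2 + 1))⁻¹ := hB z hz
      _ ≤ B * (‖z‖ ^ 3)⁻¹ := by
          refine mul_le_mul_of_nonneg_left (inv_anti₀ (by positivity) ?_) hB0
          calc ‖z‖ ^ 3 = ‖z‖ ^ 3 * 1 := (mul_one _).symm
            _ ≤ ‖z‖ ^ 3 * ‖z‖ ^ n := mul_le_mul_of_nonneg_left (one_le_pow₀ hz1) (by positivity)
            _ = ‖z‖ ^ (n + 2 + 1) := by ring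
      _ ≤ max B (27 * B') * (‖z‖ ^ 3)⁻¹ := mul_le_mul_of_nonneg_right (le_max_left _ _) (by positivity)
  · have hzle : ‖z‖ ≤ 3 := (not_le.1 hz).le
    have h1 : ‖iteratedFDeriv ℝ (n + 2) (newtonFar 1 2) z‖ ≤ B' := hB' z (mem_closedBall_zero_iff.2 hzle)
    have h2 : (1 : ℝ) ≤ 27 * (‖z‖ ^ 3)⁻¹ := by
      rw [le_mul_inv_iff₀ (by positivity), one_mul]
      calc ‖z‖ ^ 3 ≤ 3 ^ 3 := pow_le_pow_left₀ hz0.le hzle 3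
        _ = 27 := by norm_num
    calc ‖iteratedFDeriv ℝ (n + 2) (newtonFar 1 2) z‖ ≤ B' * 1 := by rw [mul_one]; exact h1
      _ ≤ B' * (27 * (‖z‖ ^ 3)⁻¹) := mul_le_mul_of_nonneg_left h2 hB'0
      _ = 27 * B' * (‖z‖ ^ 3)⁻¹ := by ring
      _ ≤ max B (27 * B') * (‖z‖ ^ 3)⁻¹ := mul_le_mul_of_nonneg_right (le_max_right _ _) (by positivity)

/-- **All derivatives of the far kernel `Φ = D²Γ∞` decay like `(1+|z|)⁻³`.** [folklore] -/
theorem exists_hasDecay_iteratedFDeriv_fderiv2_newtonFar (n : ℕ) :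
    ∃ M, HasDecay 3 M (iteratedFDeriv ℝ n (fderiv ℝ (fderiv ℝ (newtonFar (1 : ℝ) 2)))) := by
  obtain ⟨M, hM⟩ := exists_hasDecay_iteratedFDeriv_newtonFar n
  refine ⟨M, fun z => ?_⟩
  rw [norm_iteratedFDeriv_fderiv, norm_iteratedFDeriv_fderiv]
  exact hM z

/-! ### The near potential: all derivatives under the integral sign -/

variable {F : Type*} [NormedAddCommGroup F] [NormedSpace ℝ F] [CompleteSpace F]

/-- **All-orders differentiation under the integral sign against a compactly supported `L¹` kernel**:
for `k ∈ L¹` vanishing off a ball and `g ∈ Cⁿ`,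
`Dⁿ(∫ k(z) • g(· − z) dz)(x) m = ∫ k(z) • Dⁿg(x − z) m dz`. [folklore] -/
theorem iteratedFDeriv_integral_smul_comp_sub_apply {k : EuclideanSpace ℝ (Fin 3) → ℝ} {ρ : ℝ}
    (hk : Integrable k) (hkρ : ∀ z, ρ < ‖z‖ → k z = 0) :
    ∀ (n : ℕ) {g : EuclideanSpace ℝ (Fin 3) → F}, ContDiff ℝ n g →
      ∀ (x : EuclideanSpace ℝ (Fin 3)) (m : Fin n → EuclideanSpace ℝ (Fin 3)),
        iteratedFDeriv ℝ n (fun x => ∫ z, k z • g (x - z)) x m =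
          ∫ z, k z • iteratedFDeriv ℝ n g (x - z) m := by
  intro n
  induction n with
  | zero =>
    intro g hg x m
    simp only [iteratedFDeriv_zero_apply]
  | succ n ih =>
    intro g hg x m
    have hg1 : ContDiff ℝ 1 g := hg.of_le (by exact_mod_cast Nat.succ_le_succ (Nat.zero_le n))
    have hI : ContDiff ℝ (n + 1 : ℕ) (fun x => ∫ z, k z • g (x - z)) :=
      contDiff_integral_smul_comp_sub hk hkρ (n + 1) hg
    have hDI : ContDiff ℝ n (fderiv ℝ fun x => ∫ z, k z • g (x - z)) :=
      hI.fderiv_right (by push_cast; exact le_rfl)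
    set a := m (Fin.last n) with ha
    have hga : ContDiff ℝ n fun w => fderiv ℝ g w a := by
      have := (show ((n + 1 : ℕ) : WithTop ℕ∞) = (n : WithTop ℕ∞) + 1 by push_cast; rfl) ▸ hg
      exact (contDiff_succ_iff_fderiv_apply.1 this).2.2 a
    rw [iteratedFDeriv_succ_apply_right, ← iteratedFDeriv_clm_apply_const_apply hDI le_rfl]
    have heq : (fun y => fderiv ℝ (fun x => ∫ z, k z • g (x - z)) y a) =
        fun y => ∫ z, k z • (fun w => fderiv ℝ g w a) (y - z) :=
      funext fun y => fderiv_integral_smul_comp_sub_apply hk hkρ hg1 y a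
    rw [heq, ih hga x (Fin.init m)]
    refine integral_congr_ae (Eventually.of_forall fun z => ?_)
    simp only
    rw [iteratedFDeriv_succ_apply_right, ← ha, iteratedFDeriv_clm_apply_const_apply
      (hg.fderiv_right (by push_cast; exact le_rfl)) le_rfl]

open Literature.Analysis.FluidPDE.PineauVicol2026 (hasFDerivAt_integral_clm_apply_comp_sub_decay
  fderiv_integral_clm_apply_comp_sub_apply_decay integrable_clm_apply_comp_sub_decay
  continuous_integral_clm_apply_comp_sub_decay hasDecay_two_evalDiag)

/-! ### Decaying kernels against decaying weights: all derivatives under the integral sign -/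

section FarAll

variable {F' : Type*} [NormedAddCommGroup F'] [NormedSpace ℝ F']
variable {G' : Type*} [NormedAddCommGroup G'] [NormedSpace ℝ G'] [CompleteSpace G']

/-- Decay of a directional derivative `z ↦ DΦ(z) a` and of its iterated derivatives:
`‖Dᵏ(DΦ(·)a)(z)‖ ≤ ‖a‖ ‖D^{k+1}Φ(z)‖`. [folklore] -/
theorem norm_iteratedFDeriv_fderiv_apply_le_of_contDiff {Φ : EuclideanSpace ℝ (Fin 3) → F'} {n : ℕ}
    (hΦ : ContDiff ℝ (n + 1 : ℕ) Φ) (a : EuclideanSpace ℝ (Fin 3)) {k : ℕ} (hk : k ≤ n)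
    (z : EuclideanSpace ℝ (Fin 3)) :
    ‖iteratedFDeriv ℝ k (fun w => fderiv ℝ Φ w a) z‖ ≤ ‖a‖ * ‖iteratedFDeriv ℝ (k + 1) Φ z‖ := by
  have hD : ContDiff ℝ n (fderiv ℝ Φ) := hΦ.fderiv_right (by push_cast; exact le_rfl)
  rw [← norm_iteratedFDeriv_fderiv]
  exact norm_iteratedFDeriv_clm_apply_const hD.contDiffAt (by exact_mod_cast hk)

/-- **`Cⁿ` regularity of `x ↦ ∫ L(y)(Φ(x − y)) dy`** for `Φ ∈ Cⁿ` whose derivatives up to order `n`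
decay like `(1+|z|)⁻³` and a continuous weight `‖L y‖ ≤ A/(1+|y|)²` (induction on `n` through the
directional derivatives `∂ₐ ∫ L(y)(Φ(x − y)) dy = ∫ L(y)(DΦ(x − y)a) dy`). [folklore] -/
theorem contDiff_integral_clm_apply_comp_sub_decay_of_forall :
    ∀ (n : ℕ) {Φ : EuclideanSpace ℝ (Fin 3) → F'} {L : EuclideanSpace ℝ (Fin 3) → F' →L[ℝ] G'},
      ContDiff ℝ n Φ → (∀ k ≤ n, ∃ M, HasDecay 3 M (iteratedFDeriv ℝ k Φ)) →
      Continuous L → ∀ {A : ℝ}, HasDecay 2 A L →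
      ContDiff ℝ n (fun x => ∫ y, L y (Φ (x - y))) := by
  intro n
  induction n with
  | zero =>
    intro Φ L hΦ hdec hLc A hL
    obtain ⟨M₀, hM₀⟩ := hdec 0 le_rfl
    have h0 : HasDecay 3 M₀ Φ := fun z => by rw [← norm_iteratedFDeriv_zero (𝕜 := ℝ)]; exact hM₀ z
    exact contDiff_zero.2 (continuous_integral_clm_apply_comp_sub_decay hΦ.continuous h0 hLc hL)
  | succ n ih =>
    intro Φ L hΦ hdec hLc A hL
    obtain ⟨M₀, hM₀⟩ := hdec 0 (Nat.zero_le _)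
    obtain ⟨M₁, hM₁⟩ := hdec 1 (Nat.succ_le_succ (Nat.zero_le _))
    have h0 : HasDecay 3 M₀ Φ := fun z => by rw [← norm_iteratedFDeriv_zero (𝕜 := ℝ)]; exact hM₀ z
    have h1 : HasDecay 3 M₁ (fderiv ℝ Φ) := fun z => by rw [← norm_iteratedFDeriv_one]; exact hM₁ z
    have hΦ1 : ContDiff ℝ 1 Φ := hΦ.of_le (by exact_mod_cast Nat.succ_le_succ (Nat.zero_le n))
    rw [show ((n + 1 : ℕ) : WithTop ℕ∞) = (n : WithTop ℕ∞) + 1 by push_cast; rfl,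
      contDiff_succ_iff_fderiv_apply]
    refine ⟨fun x => (hasFDerivAt_integral_clm_apply_comp_sub_decay hΦ1 h0 h1 hLc hL x).differentiableAt,
      fun h => absurd h (by exact_mod_cast WithTop.natCast_ne_top n), fun a => ?_⟩
    have hΦa : ContDiff ℝ n fun w => fderiv ℝ Φ w a := by
      have := (show ((n + 1 : ℕ) : WithTop ℕ∞) = (n : WithTop ℕ∞) + 1 by push_cast; rfl) ▸ hΦ
      exact (contDiff_succ_iff_fderiv_apply.1 this).2.2 a
    have hdeca : ∀ k ≤ n, ∃ M, HasDecay 3 M (iteratedFDeriv ℝ k fun w => fderiv ℝ Φ w a) := by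
      intro k hk
      obtain ⟨M, hM⟩ := hdec (k + 1) (Nat.succ_le_succ hk)
      refine ⟨‖a‖ * M, fun z => ?_⟩
      calc ‖iteratedFDeriv ℝ k (fun w => fderiv ℝ Φ w a) z‖ ≤ ‖a‖ * ‖iteratedFDeriv ℝ (k + 1) Φ z‖ :=
            norm_iteratedFDeriv_fderiv_apply_le_of_contDiff hΦ a hk z
        _ ≤ ‖a‖ * (M * ((1 + ‖z‖) ^ 3)⁻¹) := mul_le_mul_of_nonneg_left (hM z) (norm_nonneg _)
        _ = ‖a‖ * M * ((1 + ‖z‖) ^ 3)⁻¹ := by ring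
    have heq : (fun x => fderiv ℝ (fun x => ∫ y, L y (Φ (x - y))) x a) =
        fun x => ∫ y, L y ((fun w => fderiv ℝ Φ w a) (x - y)) :=
      funext fun x => fderiv_integral_clm_apply_comp_sub_apply_decay hΦ1 h0 h1 hLc hL x a
    rw [heq]
    exact ih hΦa hdeca hLc hL

/-- **All-orders differentiation under the integral sign, decay class**:
`Dⁿ(∫ L(y)(Φ(· − y)) dy)(x) m = ∫ L(y)(DⁿΦ(x − y) m) dy` for `Φ ∈ Cⁿ` with derivatives up to order
`n` decaying like `(1+|z|)⁻³` and a continuous weight `‖L y‖ ≤ A/(1+|y|)²`. [folklore] -/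
theorem iteratedFDeriv_integral_clm_apply_comp_sub_decay_apply :
    ∀ (n : ℕ) {Φ : EuclideanSpace ℝ (Fin 3) → F'} {L : EuclideanSpace ℝ (Fin 3) → F' →L[ℝ] G'},
      ContDiff ℝ n Φ → (∀ k ≤ n, ∃ M, HasDecay 3 M (iteratedFDeriv ℝ k Φ)) →
      Continuous L → ∀ {A : ℝ}, HasDecay 2 A L →
      ∀ (x : EuclideanSpace ℝ (Fin 3)) (m : Fin n → EuclideanSpace ℝ (Fin 3)),
        iteratedFDeriv ℝ n (fun x => ∫ y, L y (Φ (x - y))) x m =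
          ∫ y, L y (iteratedFDeriv ℝ n Φ (x - y) m) := by
  intro n
  induction n with
  | zero =>
    intro Φ L hΦ hdec hLc A hL x m
    simp only [iteratedFDeriv_zero_apply]
  | succ n ih =>
    intro Φ L hΦ hdec hLc A hL x m
    obtain ⟨M₀, hM₀⟩ := hdec 0 (Nat.zero_le _)
    obtain ⟨M₁, hM₁⟩ := hdec 1 (Nat.succ_le_succ (Nat.zero_le _))
    have h0 : HasDecay 3 M₀ Φ := fun z => by rw [← norm_iteratedFDeriv_zero (𝕜 := ℝ)]; exact hM₀ z
    have h1 : HasDecay 3 M₁ (fderiv ℝ Φ) := fun z => by rw [← norm_iteratedFDeriv_one]; exact hM₁ z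
    have hΦ1 : ContDiff ℝ 1 Φ := hΦ.of_le (by exact_mod_cast Nat.succ_le_succ (Nat.zero_le n))
    have hI : ContDiff ℝ (n + 1 : ℕ) (fun x => ∫ y, L y (Φ (x - y))) :=
      contDiff_integral_clm_apply_comp_sub_decay_of_forall (n + 1) hΦ hdec hLc hL
    have hDI : ContDiff ℝ n (fderiv ℝ fun x => ∫ y, L y (Φ (x - y))) :=
      hI.fderiv_right (by push_cast; exact le_rfl)
    set a := m (Fin.last n) with ha
    have hΦa : ContDiff ℝ n fun w => fderiv ℝ Φ w a := by
      have := (show ((n + 1 : ℕ) : WithTop ℕ∞) = (n : WithTop ℕ∞) + 1 by push_cast; rfl) ▸ hΦ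
      exact (contDiff_succ_iff_fderiv_apply.1 this).2.2 a
    have hdeca : ∀ k ≤ n, ∃ M, HasDecay 3 M (iteratedFDeriv ℝ k fun w => fderiv ℝ Φ w a) := by
      intro k hk
      obtain ⟨M, hM⟩ := hdec (k + 1) (Nat.succ_le_succ hk)
      refine ⟨‖a‖ * M, fun z => ?_⟩
      calc ‖iteratedFDeriv ℝ k (fun w => fderiv ℝ Φ w a) z‖ ≤ ‖a‖ * ‖iteratedFDeriv ℝ (k + 1) Φ z‖ :=
            norm_iteratedFDeriv_fderiv_apply_le_of_contDiff hΦ a hk z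
        _ ≤ ‖a‖ * (M * ((1 + ‖z‖) ^ 3)⁻¹) := mul_le_mul_of_nonneg_left (hM z) (norm_nonneg _)
        _ = ‖a‖ * M * ((1 + ‖z‖) ^ 3)⁻¹ := by ring
    rw [iteratedFDeriv_succ_apply_right, ← iteratedFDeriv_clm_apply_const_apply hDI le_rfl]
    have heq : (fun x => fderiv ℝ (fun x => ∫ y, L y (Φ (x - y))) x a) =
        fun x => ∫ y, L y ((fun w => fderiv ℝ Φ w a) (x - y)) :=
      funext fun x => fderiv_integral_clm_apply_comp_sub_apply_decay hΦ1 h0 h1 hLc hL x a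
    rw [heq, ih hΦa hdeca hLc hL x (Fin.init m)]
    refine integral_congr_ae (Eventually.of_forall fun z => ?_)
    simp only
    rw [iteratedFDeriv_succ_apply_right, ← ha, iteratedFDeriv_clm_apply_const_apply
      (hΦ.fderiv_right (by push_cast; exact le_rfl)) le_rfl]

omit [CompleteSpace G'] in
/-- The integrand of the all-orders formula is integrable. [folklore] -/
theorem integrable_clm_apply_iteratedFDeriv_comp_sub_decay {n : ℕ} {Φ : EuclideanSpace ℝ (Fin 3) → F'}
    {L : EuclideanSpace ℝ (Fin 3) → F' →L[ℝ] G'} (hΦ : ContDiff ℝ n Φ) {M : ℝ}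
    (hM : HasDecay 3 M (iteratedFDeriv ℝ n Φ)) (hLc : Continuous L) {A : ℝ} (hL : HasDecay 2 A L)
    (x : EuclideanSpace ℝ (Fin 3)) (m : Fin n → EuclideanSpace ℝ (Fin 3)) :
    Integrable fun y => L y (iteratedFDeriv ℝ n Φ (x - y) m) := by
  have hc : Continuous fun z => iteratedFDeriv ℝ n Φ z m :=
    (hΦ.continuous_iteratedFDeriv le_rfl).eval_const m
  have hd : HasDecay 3 (M * ∏ i, ‖m i‖) fun z => iteratedFDeriv ℝ n Φ z m := fun z => by
    calc ‖iteratedFDeriv ℝ n Φ z m‖ ≤ ‖iteratedFDeriv ℝ n Φ z‖ * ∏ i, ‖m i‖ :=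
          ContinuousMultilinearMap.le_opNorm _ _
      _ ≤ M * ((1 + ‖z‖) ^ 3)⁻¹ * ∏ i, ‖m i‖ := mul_le_mul_of_nonneg_right (hM z) (by positivity)
      _ = M * (∏ i, ‖m i‖) * ((1 + ‖z‖) ^ 3)⁻¹ := by ring
  exact integrable_clm_apply_comp_sub_decay hc hd hLc hL x

end FarAll


open Literature.Analysis.FluidPDE.PineauVicol2026 (hasDecay_two_evalDiag)

/-! ### The far potential at all orders -/

/-- The far kernel `Φ = D²Γ∞^{1,2}` is smooth. [folklore] -/
theorem contDiff_fderiv2_newtonFar_all (n : ℕ) :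
    ContDiff ℝ n (fderiv ℝ (fderiv ℝ (newtonFar (1 : ℝ) 2))) :=
  ((contDiff_newtonFar one_pos one_lt_two (n := (n + 2 : ℕ))).fderiv_right (m := (n + 1 : ℕ))
    (by push_cast; exact le_rfl)).fderiv_right (m := n) (by push_cast; exact le_rfl)

/-- **The far potential of a continuous field in a decay class is smooth**, at every finite order. [folklore] -/
theorem contDiff_farPotential_decay_all (n : ℕ) {v : EuclideanSpace ℝ (Fin 3) → EuclideanSpace ℝ (Fin 3)}
    (hvc : Continuous v) {Cd : ℝ} (hv : ∀ y, ‖v y‖ ≤ Cd / (1 + ‖y‖)) :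
    ContDiff ℝ n (farPotential 1 2 v) := by
  rw [farPotential_eq]
  exact contDiff_integral_clm_apply_comp_sub_decay_of_forall n (contDiff_fderiv2_newtonFar_all n)
    (fun k _ => exists_hasDecay_iteratedFDeriv_fderiv2_newtonFar k) (continuous_evalDiag.comp hvc)
    (hasDecay_two_evalDiag hv)

/-- **The pressure potential of a smooth field in a decay class is smooth**, at every finite order. [folklore] -/
theorem contDiff_pressurePotential_decay_all (n : ℕ) {v : EuclideanSpace ℝ (Fin 3) → EuclideanSpace ℝ (Fin 3)}
    (hvs : ContDiff ℝ ∞ v) {Cd : ℝ} (hv : ∀ y, ‖v y‖ ≤ Cd / (1 + ‖y‖)) :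
    ContDiff ℝ n (pressurePotential v) := by
  have hN : ContDiff ℝ n (nearPotential 1 2 v) :=
    contDiff_nearPotential zero_le_one one_lt_two n (by exact_mod_cast contDiff_infty.1 hvs (n + 2))
  have hF : ContDiff ℝ n (farPotential 1 2 v) := contDiff_farPotential_decay_all n hvs.continuous hv
  have e : pressurePotential v = fun x => -nearPotential 1 2 v x - farPotential 1 2 v x := rfl
  rw [e]
  exact hN.neg.sub hF

/-- **All derivatives of the far potential: the formula**
`DⁿQ₂[v](x) m = ∫ DⁿΦ(x − y) m (v y) (v y) dy`, `Φ = D²Γ∞`. [folklore] -/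
theorem iteratedFDeriv_farPotential_apply (n : ℕ) {v : EuclideanSpace ℝ (Fin 3) → EuclideanSpace ℝ (Fin 3)}
    (hvc : Continuous v) {Cd : ℝ} (hv : ∀ y, ‖v y‖ ≤ Cd / (1 + ‖y‖)) (x : EuclideanSpace ℝ (Fin 3))
    (m : Fin n → EuclideanSpace ℝ (Fin 3)) :
    iteratedFDeriv ℝ n (farPotential 1 2 v) x m =
      ∫ y, iteratedFDeriv ℝ n (fderiv ℝ (fderiv ℝ (newtonFar (1 : ℝ) 2))) (x - y) m (v y) (v y) := by
  rw [farPotential_eq, iteratedFDeriv_integral_clm_apply_comp_sub_decay_apply n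
    (L := fun y => evalDiag (v y)) (contDiff_fderiv2_newtonFar_all n)
    (fun k _ => exists_hasDecay_iteratedFDeriv_fderiv2_newtonFar k) (continuous_evalDiag.comp hvc)
    (hasDecay_two_evalDiag hv) x m]
  rfl


/-- **Registered sub-goal `stub_apexRegKernelDecay` of `stub_apexRegularity`**: every derivative of the far Newton
kernel `Φ = D²Γ∞^{1,2}` decays like `(1+|z|)⁻³` (`exists_hasDecay_iteratedFDeriv_fderiv2_newtonFar`). [folklore] -/
theorem stub_apexRegKernelDecay :
    ∀ n : ℕ, ∃ M : ℝ, FourierNS.HasDecay 3 M (iteratedFDeriv ℝ n (fderiv ℝ (fderiv ℝ (newtonFar (1 : ℝ)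
      2)))) :=
  fun n => exists_hasDecay_iteratedFDeriv_fderiv2_newtonFar n

end Summit.NavierStokesRegularity.NavierStokesRegularity.Theorems.RellichScarScarRigidity

end
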